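import Summits.Parity.GeneralizedHardyLittlewood.Theses.OneSidedAggregateExchangeRate
import Literature.NumberTheory.Sieve.SingularSeriesProofs
import HarnessLib

/-!
# BC3 birth skeleton — crux `ExchangeRateSieve` (rank 5, theorem-grade XL) of route `OneSidedAggregateExchangeRate`
(Parity / GeneralizedHardyLittlewood; item stmt-Parity-18975)

Line-writer seat `linewriter-parity-certcluster-1` g0, 2026-08-31: MATERIALISES the line card already in the tree,
`Cruxes/ExchangeRateSieve/Lines/birth.md` (registrar `planner-skel-stmt-Parity-18975-0`, 2026-08-17 — its `.lean` never
reached the tree: the Theses module was farm-unbuilt that day; the type-sketch seat's 2-stub birth `ExchangeRateSieve_birth.lean`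
5703f0c3e7850a6e is gate-side only).  Same four-stub cut, same vocabulary, typed here over the ROUTE DECLS (imported), so that
`ExchangeRateSieve_of` concludes the crux BY NAME.

LINE (the EXCHANGE-RATE SIEVE, 2001 `exchange.tex` Thm C Steps 1–4 + Prop `agg`, soft form Θ = 4).  Write the FM-format
lower-bound sieve for the twin pair with the route's step weight `g = g_s` (the weight typed inside K2 =
`OneSidedSiftedComparison`) as the identity `Σ_{d∈D} g(d) S(c;d) = Σ_{x<n≤2x} c(n) G(n)`, `G(n) = Σ_{d∈D, d∣n, n/d y-rough} g(d)`
(`§Vocabulary`: `GW`).  On primes `G = g(1) = 1`, so for `c = a = log(·+2)·1_{·+2 prime}` the prime part is the log-weighted twin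
sum `T'(x)` (`twinLogW`); composite cells with `G > 0` (plus the CORNER of the three-prime cell, where `G = −1`) are a COST
`𝒞_δ(c)` (`costW`; paid at exchange rate 4 by the upper-bound sieve, S3), cells with `G < 0` are dropped by positivity EXCEPT
the three-prime cell Δ̄′₃ of K1 = `ThreePrimeShiftDensity`, where `G ∈ {−2, −1}` and K1 CREDITS one tenth of the HL mass (S1);
K2 (used once, only as `≥`) replaces the a-side main term by the b-side (model) main term, whose value minus 4×(model cost)
is the certified soft value `Φ₄(g_s) ∈ [−0.09507, −0.09358] > −1/10` (S2); S4 turns the dyadic log-weighted bound into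
`TwinLowerDensity`.  Composition (PROVED below): `ε₂ := (Φ₀ + 1/10)/4` in S2, `θ := C₂(Φ₀ + 1/10)/8` in K2 and S3,
`δ := min δ₀ 1/28`; then `T'(x) ≥ (5/4)·C₂(Φ₀ + 1/10)·x/log x`.
Stubs: `stub_cellCredit` (S1, M: finite rearrangement + divisor census of `p₁p₂p₃`), `stub_modelSoftValue` (S2, XL: model
cell asymptotics + the certified inequality — LOAD-BEARING), `stub_upperSieveCost` (S3, L/XL: bilinear BV + Selberg upper
bound, factor `2/(1/2) = 4`), `stub_windowToDensity` (S4, S: `T'(x) ≤ log(2x+2)·π₂(2x)`, monotonicity).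
None restates the crux: S1/S3/S4 are parity-blind and unconditional, S2 is a statement about the MODEL `b` only; the crux's
hypotheses K1, K2 enter only in the composition (BC3 probes of the 08-17 card: 8/8 FAIL, `Lines/bc3_probes.md`).
-/

noncomputable section

namespace Summit.Parity.GeneralizedHardyLittlewood.Cruxes.ExchangeRateSieve.Birth

open scoped BigOperators Topology Classical
open Literature.NumberTheory.Sieve
open Summit.Parity.GeneralizedHardyLittlewood.Theses.OneSidedAggregateExchangeRate

/-! ## Vocabulary — verbatim the `let`s of `OneSidedSiftedComparison` (K2), as functions of `x` (and `δ`) -/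

/-- `z = exp((log log x)²)`. -/
def zW (x : ℕ) : ℝ := Real.exp (Real.log (Real.log (x : ℝ)) ^ 2)
/-- `V = ∏_{p<z} (1 − 1/p)`. -/
def VW (x : ℕ) : ℝ := ∏ p ∈ (Finset.range ⌈zW x⌉₊).filter Nat.Prime, (1 - 1 / (p : ℝ))
/-- `a(n) = log(n+2)·1_{n+2 prime}` (the twin host). -/
def aW : ℕ → ℝ := fun n => if (n + 2).Prime then Real.log ((n : ℝ) + 2) else 0
/-- `b(n) = 1_{n+2 is z-rough}/V` (the FM sieve model of `a`). -/
def bW (x : ℕ) : ℕ → ℝ := fun n => if ∀ p ∈ (n + 2).primeFactors, zW x ≤ (p : ℝ) then 1 / VW x else 0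
/-- `y = x^{1/7}` (bottom of the Type-II window). -/
def yW (x : ℕ) : ℝ := (x : ℝ) ^ ((1 : ℝ) / 7)
/-- `S(c; d) = Σ_{x<n≤2x, d∣n, n/d y-rough} c(n)`. -/
def SW (x : ℕ) : (ℕ → ℝ) → ℕ → ℝ := fun c d =>
  ∑ n ∈ (Finset.Ioc x (2 * x)).filter (fun n : ℕ => d ∣ n ∧ ∀ p ∈ (n / d).primeFactors, yW x ≤ (p : ℝ)), c n
/-- `idx p = ⌊140 log p/log x⌋ − 20` (box index of mesh 1/140 above 1/7). -/
def idxW (x : ℕ) : ℕ → ℕ := fun p => ⌊140 * Real.log (p : ℝ) / Real.log (x : ℝ)⌋₊ - 20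
/-- the certified three-prime-cell pattern of `g_s` (values −1/−2/−5). -/
def g₃W : ℕ → ℕ → ℕ → ℝ := fun i j k =>
  if i = 0 ∧ j = 0 ∧ k = 0 then -1
  else if (i = 0 ∧ j = 0) ∨ (i = 0 ∧ j = 1 ∧ 2 ≤ k) ∨ (i = 0 ∧ j = 2 ∧ 5 ≤ k) ∨ (i = 1 ∧ j = 1 ∧ 5 ≤ k) then -2 else -5
/-- the step weight `g = g_s` (`1, −1, +1` on `ω(d) = 0, 1, 2`; the pattern on `ω(d) = 3`; `0` beyond). -/
def gW (x : ℕ) : ℕ → ℝ := fun d =>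
  if d.primeFactors.card = 0 then 1 else if d.primeFactors.card = 1 then -1 else if d.primeFactors.card = 2 then 1
  else if d.primeFactors.card = 3 then
    g₃W (idxW x d.minFac) ((∑ p ∈ d.primeFactors, idxW x p) - idxW x d.minFac - idxW x (d.primeFactors.sup id))
      (idxW x (d.primeFactors.sup id))
  else 0
/-- `D = D_x(1/7, δ)`: squarefree `y`-rough `d ≤ x^{1/2−δ}`. -/
def DW (x : ℕ) (δ : ℝ) : Finset ℕ :=
  (Finset.Icc 1 ⌊(x : ℝ) ^ ((1 : ℝ) / 2 - δ)⌋₊).filter (fun d : ℕ => Squarefree d ∧ ∀ p ∈ d.primeFactors, yW x ≤ (p : ℝ))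

/-- K2 unfolded over the vocabulary (PROVED, definitional). -/
theorem oneSidedSiftedComparison_iff :
    OneSidedSiftedComparison ↔
      ∀ δ : ℝ, 0 < δ → δ < 1 / 7 → ∀ θ : ℝ, 0 < θ → ∃ x₀ : ℕ, ∀ x : ℕ, x₀ ≤ x →
        -θ * (x : ℝ) / Real.log (x : ℝ) ≤ ∑ d ∈ DW x δ, gW x d * (SW x aW d - SW x (bW x) d) :=
  Iff.rfl

/-! ## Vocabulary — the sieve transform, the cost functional, the prime part -/

/-- the sieve transform `G(n) = Σ_{d ∈ D, d ∣ n, n/d y-rough} g(d)` of the weight. -/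
def GW (x : ℕ) (δ : ℝ) (n : ℕ) : ℝ :=
  ∑ d ∈ (DW x δ).filter (fun d : ℕ => d ∣ n ∧ ∀ p ∈ (n / d).primeFactors, yW x ≤ (p : ℝ)), gW x d
/-- K1's three-prime cell `Δ̄′₃`: `n = p₁p₂p₃`, `x^{1/7} ≤ p₁ < p₂ < p₃ ≤ x^{1/2}` (verbatim K1, without the primality of `n+2`). -/
def InCell (x n : ℕ) : Prop :=
  ∃ p₁ p₂ p₃ : ℕ, p₁.Prime ∧ p₂.Prime ∧ p₃.Prime ∧ n = p₁ * p₂ * p₃ ∧ (x : ℝ) ^ ((1 : ℝ) / 7) ≤ (p₁ : ℝ) ∧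
    p₁ < p₂ ∧ p₂ < p₃ ∧ (p₃ : ℝ) ≤ (x : ℝ) ^ ((1 : ℝ) / 2)
/-- the CORNER of the cell: largest prime factor above the level `x^{1/2−δ}` (there `G = −1`, not `−2`). -/
def InCorner (x : ℕ) (δ : ℝ) (n : ℕ) : Prop :=
  InCell x n ∧ (x : ℝ) ^ ((1 : ℝ) / 2 - δ) < ((n.primeFactors.sup id : ℕ) : ℝ)
/-- the composite COST functional `𝒞_δ(c) = Σ_{x<n≤2x, n composite} c(n)·(G(n)⁺ + 1_{corner}(n))`. -/
def costW (x : ℕ) (δ : ℝ) (c : ℕ → ℝ) : ℝ :=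
  ∑ n ∈ (Finset.Ioc x (2 * x)).filter (fun n : ℕ => ¬ n.Prime),
    c n * (max (GW x δ n) 0 + (if InCorner x δ n then 1 else 0))
/-- the prime part `T'(x) = Σ_{x<p≤2x, p and p+2 prime} log(p+2)` (log-weighted dyadic twin count). -/
def twinLogW (x : ℕ) : ℝ :=
  ∑ n ∈ (Finset.Ioc x (2 * x)).filter (fun n : ℕ => n.Prime ∧ (n + 2).Prime), Real.log ((n : ℝ) + 2)

/-! ## The four stubs (statements spelled out; `Signature.*` are the same terms by `rfl`, see the `example`s) -/

/-- S1 signature. -/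
def Signature.stub_cellCredit : Prop :=
  ∀ δ : ℝ, 0 < δ → δ < 1 / 14 → ∃ x₀ : ℕ, ∀ x : ℕ, x₀ ≤ x →
    ∑ d ∈ DW x δ, gW x d * SW x aW d - costW x δ aW +
        2 * Real.log (x : ℝ) *
          (((Finset.Ioc x (2 * x)).filter (fun n : ℕ => (n + 2).Prime ∧ ∃ p₁ p₂ p₃ : ℕ, p₁.Prime ∧ p₂.Prime ∧
              p₃.Prime ∧ n = p₁ * p₂ * p₃ ∧ (x : ℝ) ^ ((1 : ℝ) / 7) ≤ (p₁ : ℝ) ∧ p₁ < p₂ ∧ p₂ < p₃ ∧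
                (p₃ : ℝ) ≤ (x : ℝ) ^ ((1 : ℝ) / 2))).card : ℝ) ≤
      twinLogW x

/-- **S1 `stub_cellCredit`** (M): the cell census.  For `0 < δ < 1/14` and large `x`,
`Σ_d g S(a;d) − 𝒞_δ(a) + 2·log x·W₃(x) ≤ T'(x)`: the sieve identity `Σ_d g S(a;d) = Σ_n a(n)G(n)`; `G(p) = g(1) = 1` on primes
(`p > x^{1/2−δ}`, so `d = p ∉ D`); `G = 0` on non-`y`-rough `n`; on the cell `n = p₁p₂p₃` every pair product exceeds `√x`
and `p₂ < √2·x^{3/7} ≤ x^{1/2−δ}`, so `G = 1 − 3 = −2` inside and `= −1` on the corner `p₃ > x^{1/2−δ}` — the corner's extra `+a(n)`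
is booked in `𝒞_δ(a)`; everywhere else `aG ≤ aG⁺`; K1's set = cell ∩ {n+2 prime} and `a(n) = log(n+2) ≥ log x` there. -/
theorem stub_cellCredit :
    ∀ δ : ℝ, 0 < δ → δ < 1 / 14 → ∃ x₀ : ℕ, ∀ x : ℕ, x₀ ≤ x →
      ∑ d ∈ DW x δ, gW x d * SW x aW d - costW x δ aW +
          2 * Real.log (x : ℝ) *
            (((Finset.Ioc x (2 * x)).filter (fun n : ℕ => (n + 2).Prime ∧ ∃ p₁ p₂ p₃ : ℕ, p₁.Prime ∧ p₂.Prime ∧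
                p₃.Prime ∧ n = p₁ * p₂ * p₃ ∧ (x : ℝ) ^ ((1 : ℝ) / 7) ≤ (p₁ : ℝ) ∧ p₁ < p₂ ∧ p₂ < p₃ ∧
                  (p₃ : ℝ) ≤ (x : ℝ) ^ ((1 : ℝ) / 2))).card : ℝ) ≤
        twinLogW x := by
  sorry

example : Signature.stub_cellCredit := stub_cellCredit

/-- S2 signature. -/
def Signature.stub_modelSoftValue : Prop :=
  ∃ Φ₀ : ℝ, -1 / 10 < Φ₀ ∧ ∀ ε : ℝ, 0 < ε → ∃ δ₀ : ℝ, 0 < δ₀ ∧ ∀ δ : ℝ, 0 < δ → δ ≤ δ₀ → ∃ x₀ : ℕ, ∀ x : ℕ, x₀ ≤ x →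
    (Φ₀ - ε) * (2 * twinPrimeConst) * (x : ℝ) / Real.log (x : ℝ) ≤
      ∑ d ∈ DW x δ, gW x d * SW x (bW x) d - 4 * costW x δ (bW x)

/-- **S2 `stub_modelSoftValue`** (XL, LOAD-BEARING): the model-side soft value.  Some `Φ₀ > −1/10` such that for every
`ε > 0`, all small `δ` and large `x`: `(Φ₀ − ε)·2C₂·x/log x ≤ Σ_d g S(b;d) − 4·𝒞_δ(b)`.  Why plausibly true: the fundamental
lemma (`z = x^{o(1)}`) + prime counting in boxes give `Σ_{n∈P} b = (𝔖 m(P) + o(1))·x/log x` on every sign-cell `P`, so the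
right side is `(Φ(δ) + o(1))·𝔖x/log x` with `Φ(δ) = 1 + Σ_k ∫ (G_δ − 4G_δ⁺) dμ_k − 4μ₃(corner_δ) → Φ₄(g_s)` as `δ → 0`, and
`Φ₄(g_s) ∈ [−0.09507, −0.09358]` is CERTIFIED (2001 exact rational cell geometry + interval arithmetic; re-derived by the
birth-vetting refuter: `−0.09359 ± 3·10⁻⁵`, margin 0.0064 to `−1/10` — the Lean proof must carry the exact certificate). -/
theorem stub_modelSoftValue :
    ∃ Φ₀ : ℝ, -1 / 10 < Φ₀ ∧ ∀ ε : ℝ, 0 < ε → ∃ δ₀ : ℝ, 0 < δ₀ ∧ ∀ δ : ℝ, 0 < δ → δ ≤ δ₀ → ∃ x₀ : ℕ, ∀ x : ℕ, x₀ ≤ x →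
      (Φ₀ - ε) * (2 * twinPrimeConst) * (x : ℝ) / Real.log (x : ℝ) ≤
        ∑ d ∈ DW x δ, gW x d * SW x (bW x) d - 4 * costW x δ (bW x) := by
  sorry

example : Signature.stub_modelSoftValue := stub_modelSoftValue

/-- S3 signature. -/
def Signature.stub_upperSieveCost : Prop :=
  ∀ ε : ℝ, 0 < ε → ∀ δ : ℝ, 0 < δ → δ < 1 / 7 → ∃ x₀ : ℕ, ∀ x : ℕ, x₀ ≤ x →
    costW x δ aW ≤ 4 * costW x δ (bW x) + ε * (x : ℝ) / Real.log (x : ℝ)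

/-- **S3 `stub_upperSieveCost`** (L/XL, theorem-grade): the exchange rate.  For `ε > 0`, `0 < δ < 1/7` and large `x`,
`𝒞_δ(a) ≤ 4·𝒞_δ(b) + ε·x/log x`: on each of the finitely many sign-cells `P` (products of primes `≥ x^{1/7}` in boxes, on
which `G⁺ + 1_{corner}` is constant) the shifted set `{n + 2 : n ∈ P}` has level of distribution `x^{1/2−o(1)}` (bilinear
Bombieri–Vinogradov for these convolutions, BFI 1986 Thm 0 / Motohashi), so Selberg's upper bound gives
`Σ_P a ≤ (4 + o(1))·Σ_P b + o(x/log x)` (Bombieri–Davenport factor `2/(1/2) = 4`; Ford–Maynard's axiom `U_{4+ε}`, [FMB] Prop 7.9). -/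
theorem stub_upperSieveCost :
    ∀ ε : ℝ, 0 < ε → ∀ δ : ℝ, 0 < δ → δ < 1 / 7 → ∃ x₀ : ℕ, ∀ x : ℕ, x₀ ≤ x →
      costW x δ aW ≤ 4 * costW x δ (bW x) + ε * (x : ℝ) / Real.log (x : ℝ) := by
  sorry

example : Signature.stub_upperSieveCost := stub_upperSieveCost

/-- S4 signature. -/
def Signature.stub_windowToDensity : Prop :=
  (∃ c : ℝ, 0 < c ∧ ∃ x₀ : ℕ, ∀ x : ℕ, x₀ ≤ x → c * (x : ℝ) / Real.log (x : ℝ) ≤ twinLogW x) → TwinLowerDensity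

/-- **S4 `stub_windowToDensity`** (S): from a dyadic log-weighted lower bound `c·x/log x ≤ T'(x)` (all large `x`) to
`TwinLowerDensity`: `T'(x) ≤ log(2x+2)·#{x < p ≤ 2x twin} ≤ log(2x+2)·π₂(2x)`, then `N ↦ x = ⌊N/2⌋` and monotonicity of `π₂`. -/
theorem stub_windowToDensity :
    (∃ c : ℝ, 0 < c ∧ ∃ x₀ : ℕ, ∀ x : ℕ, x₀ ≤ x → c * (x : ℝ) / Real.log (x : ℝ) ≤ twinLogW x) → TwinLowerDensity := by
  sorry

example : Signature.stub_windowToDensity := stub_windowToDensity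

/-! ## Composition -/

/-- **Composition (kernel-checked, no sorry)**: the four stubs give the ROUTE crux `ExchangeRateSieve = K2 → K1 → T` BY NAME.
Endgame: `ε₂ := (Φ₀ + 1/10)/4` in S2, `θ := C₂(Φ₀ + 1/10)/8` in K2 and S3, `δ := min δ₀ (1/28)`; summing S1, K2, S3, S2 and
`2·log x·W₃ ≥ (C₂/5)·x/log x` (K1) gives `T'(x) ≥ (5/4)·C₂(Φ₀ + 1/10)·x/log x ≥ C₂(Φ₀ + 1/10)·x/log x`, and S4 concludes. -/
theorem ExchangeRateSieve_of :
    Signature.stub_cellCredit → Signature.stub_modelSoftValue → Signature.stub_upperSieveCost →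
      Signature.stub_windowToDensity →
        Summit.Parity.GeneralizedHardyLittlewood.Theses.OneSidedAggregateExchangeRate.ExchangeRateSieve := by
  intro h1 h2 h3 h4 k2 k1
  obtain ⟨Φ₀, hΦ₀, h2⟩ := h2
  have hC₂pos : 0 < twinPrimeConst := twinPrimeConst_pos_holds
  have hηpos : 0 < Φ₀ + 1 / 10 := by linarith
  have hε₂ : 0 < (Φ₀ + 1 / 10) / 4 := by positivity
  have hθ : 0 < twinPrimeConst * (Φ₀ + 1 / 10) / 8 := by positivity
  obtain ⟨δ₀, hδ₀pos, h2⟩ := h2 _ hε₂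
  set δ : ℝ := min δ₀ (1 / 28) with hδdef
  have hδpos : 0 < δ := lt_min hδ₀pos (by norm_num)
  have hδle : δ ≤ δ₀ := min_le_left _ _
  have hδ14 : δ < 1 / 14 := (min_le_right _ _).trans_lt (by norm_num)
  have hδ7 : δ < 1 / 7 := hδ14.trans (by norm_num)
  obtain ⟨x₁, hx₁⟩ := h1 δ hδpos hδ14
  obtain ⟨x₂, hx₂⟩ := h2 δ hδpos hδle
  obtain ⟨x₃, hx₃⟩ := h3 _ hθ δ hδpos hδ7
  obtain ⟨x₄, hx₄⟩ := (oneSidedSiftedComparison_iff.mp k2) δ hδpos hδ7 _ hθ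
  obtain ⟨x₅, hx₅⟩ := k1
  refine h4 ⟨twinPrimeConst * (Φ₀ + 1 / 10), by positivity, max (max (max x₁ x₂) (max x₃ x₄)) (max x₅ 3),
    fun x hx => ?_⟩
  simp only [max_le_iff] at hx
  obtain ⟨⟨⟨hx1, hx2⟩, hx3, hx4⟩, hx5, hx6⟩ := hx
  have hx1' : (1 : ℝ) < x := by exact_mod_cast (show 1 < x by omega)
  have hxpos : (0 : ℝ) < x := by linarith
  have hL : 0 < Real.log (x : ℝ) := Real.log_pos hx1'
  have e1 := hx₁ x hx1
  have e2 := hx₂ x hx2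
  have e3 := hx₃ x hx3
  have e4 := hx₄ x hx4
  have e5 := hx₅ x hx5
  have hAB : ∑ d ∈ DW x δ, gW x d * (SW x aW d - SW x (bW x) d) =
      ∑ d ∈ DW x δ, gW x d * SW x aW d - ∑ d ∈ DW x δ, gW x d * SW x (bW x) d := by
    simp only [mul_sub, Finset.sum_sub_distrib]
  rw [hAB] at e4
  have hW : twinPrimeConst / 5 * (x : ℝ) / Real.log (x : ℝ) ≤
      2 * Real.log (x : ℝ) *
        (((Finset.Ioc x (2 * x)).filter (fun n : ℕ => (n + 2).Prime ∧ ∃ p₁ p₂ p₃ : ℕ, p₁.Prime ∧ p₂.Prime ∧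
            p₃.Prime ∧ n = p₁ * p₂ * p₃ ∧ (x : ℝ) ^ ((1 : ℝ) / 7) ≤ (p₁ : ℝ) ∧ p₁ < p₂ ∧ p₂ < p₃ ∧
              (p₃ : ℝ) ≤ (x : ℝ) ^ ((1 : ℝ) / 2))).card : ℝ) := by
    have h := mul_le_mul_of_nonneg_left e5 (show (0 : ℝ) ≤ 2 * Real.log (x : ℝ) by positivity)
    refine le_trans (le_of_eq ?_) h
    field_simp
    ring
  have hpos : 0 ≤ twinPrimeConst * (Φ₀ + 1 / 10) * (x : ℝ) / Real.log (x : ℝ) :=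
    div_nonneg (mul_nonneg (mul_pos hC₂pos hηpos).le hxpos.le) hL.le
  -- normalise every `a * x / log x` to `a * (x / log x)`: then all five inequalities are linear in the monomials
  -- `C₂·Φ₀·(x/L)`, `C₂·(x/L)` and the vocabulary atoms, and `linarith` sums them
  simp only [mul_div_assoc] at e2 e3 e4 hW hpos ⊢
  linarith [e1, e2, e3, e4, hW, hpos]

/-- **The skeleton instantiated**: the crux BY NAME modulo the four registered stubs (carries exactly their `sorry`s). -/
theorem ExchangeRateSieve_of_stubs :
    Summit.Parity.GeneralizedHardyLittlewood.Theses.OneSidedAggregateExchangeRate.ExchangeRateSieve :=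
  ExchangeRateSieve_of stub_cellCredit stub_modelSoftValue stub_upperSieveCost stub_windowToDensity

end Summit.Parity.GeneralizedHardyLittlewood.Cruxes.ExchangeRateSieve.Birth

end
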